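/-
Copyright (c) 2026 the pub-hodgecm-mathlib formalisation cell (harness21).  Prover seat hodgecm-mathlib-K2E3-p17 (g8), Track B «K2-LIT» ∕ h413
(`stmt-HodgeConjecture-24833`), line `K2_E3_EllipticInputs`, leaf (nsc-S-A′), H-layer brick LEV-3 (core) of `MEMO-H4-residues.v1.K2E3-p25-g0.md` §1 (architect
K2E3-p25 (g0); dealer K2E3-plan (g4) RULINGS #3 (R-9) D76).  2026-09-04.
-/
import Summits.HodgeConjecture.HodgeConjecture.Theorems.K2E3TwistedKernelTransport             -- ★ LEV-3 kit p859153 (this seat): transport, quotient kernels, duality on a root group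
import Summits.HodgeConjecture.HodgeConjecture.Theorems.K2E3GL3UnipotentCharacters            -- LEV-3 structure (this seat): `U₃ = U_Q·U_{α₁}`, characters, conjugation data
import Summits.HodgeConjecture.HodgeConjecture.Theorems.K2E3TwistedCoinvariantsSeparationLimit -- ★ LEV-1 (K2E3-p21 (g6)): separation by twisted coinvariants (`IsLimitOfCompactOpen` frame)
import Summits.HodgeConjecture.HodgeConjecture.Theorems.K2E3CoinvariantsInStages              -- ★ LEV-2 p859154 (K2E5-p17 (g5)): `ker_charTwist_eq_sup`
import Literature.NumberTheory.Automorphic.UnipotentRadicalCompactOpenProofs                   -- ★ `isLimitOfCompactOpen_unipotentRadicalGL`, `isClosed_unipotentRadicalGL`, `IsLimitOfCompactOpen.of_le`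
import Literature.NumberTheory.Automorphic.GLnStandardLeviUnimodular                          -- ★ `isClosed_standardLeviGL`
import Literature.NumberTheory.Automorphic.PAdicRepsSupercuspidalProofs                       -- ★ `sigmaCompactSpace_generalLinearGroup`
import HarnessLib

/-!
# Crux `H413` — K2-LIT E3, H-layer rule (lev), core: a `ψ_nd`- AND `ψ′`-DEGENERATE smooth representation of `GL₃(F)` is trivial on `U_Q`
# (`ω_{U₃,ψ_nd} = 0 ∧ ω_{U₃,ψ′} = 0 ⇒ ω_{U_Q,Ψ₁} = 0 ⇒ ω_{U_Q,Ψ} = 0 ∀ Ψ ≠ 1 ⇒ U_Q` acts trivially; Bernstein–Zelevinsky 1977, 4.7 ∕ Zelevinsky 1980, 4.3 at `n = 3`)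

Cell `hodgecm-mathlib`, Track B, line `K2_E3_EllipticInputs`, leaf (nsc-S-A′) `sig_K2E3GL3PrincipalBlockStandardSpan`; H-layer rule (lev) of the architect's memo
`MEMO-H4-residues.v1` §1 (K2E3-p25 (g0)), which absorbs the residue R2 (`Z(Δ)×a`, `Z(Δ)×aν` irreducible).  THEOREMS ONLY; count-neutral helper
(`--supports stmt-HodgeConjecture-24833 --as helper`).  `U₃ = upperUnitriangular (Fin 3) F`, `U_Q = unipotentRadicalGL F ![false,false,true]`,
`U_{α₁} = unipotentRadicalGL F id ⊓ standardLeviGL F ![false,false,true]`; `V(H,θ) = Coinvariants.ker (ω.charTwist H θ)` (★ `WhittakerTwistedJacquet`).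

THE ARGUMENT (memo (lev), verbatim).  Hypotheses: `ω` smooth, `V(U₃, ψ_nd) = V` and `V(U₃, ψ′) = V` (`ψ′(u) = ψ(u₁₂)`).
* §1 (A) the torus `diag(c,1,1)` transports `V(U₃,ψ_nd) = V` to `V(U₃,θ_c) = V`, `θ_c(u) = ψ(c u₀₁ + u₁₂)`, all `c ≠ 0`; `c = 0` is `ψ′` (★ kit TRANSPORT).
* §2 (B)+(C) STAGES (★ LEV-2 `ker_charTwist_eq_sup`, `U₃ = U_Q ⊔ U_{α₁}`): `V = V(U_Q,Ψ₁) + V(U_{α₁},χ_c)` for all `c`; every smooth character of `U_{α₁} ≅ F` is a `χ_c`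
  (★ kit duality); `U_{α₁}` acts on `A = V ⧸ V(U_Q,Ψ₁)` (normalises `U_Q`, fixes `Ψ₁`) with `A(U_{α₁},χ) = A` for every smooth `χ`, so SEPARATION (★ LEV-1) kills `A`:
  **`V(U_Q, Ψ₁) = V`** (`ker_charTwist_unipotentRadical21_eq_top_of_degenerate`).
* §3 (D) the Levi `GL₂` moves `Ψ₁` to every `Ψ_{a,b} ≠ 1` (★ structure file: `T₁₀(a)`, `diag(1,b,1)`, `P_{(01)}`), every smooth character of `U_Q ≅ F²` is a `Ψ_{a,b}`
  (★ kit), and SEPARATION on `U_Q` applied to `ω(n)v − v` gives **`ω(n) v = v` for all `n ∈ U_Q`** (`apply_eq_self_of_mem_unipotentRadical21_of_degenerate`).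
The sequel `K2E3GL3DegenerateLevelOne` turns this into «`SL`-type triviality ⇒ Schur ⇒ `dim ω = 1`, `dim r_B ω = 1`».

HONEST LABEL: HC_CM is proved only modulo the 7 printed citations (2 remaining named inputs: hLiu418 = stmt-HodgeConjecture-24832, h413 =
stmt-HodgeConjecture-24833) until rung 0 closes; count-neutral helper, closes no socket by itself.

## References
* [BernsteinZelevinskyASENS1977] I. N. Bernstein, A. V. Zelevinsky, *Induced representations of reductive p-adic groups I*, Ann. Sci. ÉNS 10 (1977), §3.2–3.5, Thm. 4.7.
* [Zelevinsky1980] A. V. Zelevinsky, *Induced representations of reductive p-adic groups II*, Ann. Sci. ÉNS 13 (1980), 3.7 (b), 4.3.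
* [BernsteinZelevinsky1976] I. N. Bernstein, A. V. Zelevinsky, Russian Math. Surveys 31:3 (1976), §2.33, §5.15.
-/

set_option autoImplicit false
-- the mandated namespace repeats `HodgeConjecture.HodgeConjecture`, as in every `Theorems/*.lean` of this sub-problem
set_option linter.dupNamespace false

noncomputable section

open Representation Matrix Literature.NumberTheory.Automorphic Literature.NumberTheory.GaloisRepresentations.IsNonarchimedeanLocalField
open scoped MatrixGroups
open Summit.HodgeConjecture.HodgeConjecture.Cruxes.H413.K2E3TwistedKernelTransport
open Summit.HodgeConjecture.HodgeConjecture.Cruxes.H413.K2E3GL3UnipotentCharacters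
open Summit.HodgeConjecture.HodgeConjecture.Cruxes.H413.K2E3TwistedCoinvariantsSeparation
open Summit.HodgeConjecture.HodgeConjecture.Cruxes.H413.K2E3CoinvariantsInStages

namespace Summit.HodgeConjecture.HodgeConjecture.Cruxes.H413.K2E3GL3DegenerateUnipotentTrivial

variable {F : Type*} [Field F] [ValuativeRel F] [TopologicalSpace F] [IsNonarchimedeanLocalField F]
  {ψ : AddChar F Circle} {V : Type*} [AddCommGroup V] [Module ℂ V] (ω : Representation ℂ (GL (Fin 3) F) V)

/-! ## §0 Topological facts on the pieces -/

omit [ValuativeRel F] [TopologicalSpace F] [IsNonarchimedeanLocalField F] in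
/-- Two characters `↥H →* ℂˣ` with the same complex values are equal. [folklore] -/
theorem monoidHom_eq_of_coe_eq {H : Type*} [Group H] {θ θ' : H →* ℂˣ} (h : ∀ x, ((θ x : ℂˣ) : ℂ) = ((θ' x : ℂˣ) : ℂ)) : θ = θ' :=
  MonoidHom.ext fun x => Units.ext (h x)

variable (F) in
/-- `U_Q` is closed, a limit of compact open subgroups, and abelian; `U_{α₁}` likewise. [cite: BernsteinZelevinskyASENS1977, §1.9, §2.1] -/
theorem pieces_topology :
    IsClosed ((unipotentRadicalGL F ![false, false, true] : Subgroup (GL (Fin 3) F)) : Set (GL (Fin 3) F)) ∧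
      IsLimitOfCompactOpen ↥(unipotentRadicalGL F ![false, false, true]) ∧
      IsClosed ((unipotentRadicalGL F (id : Fin 3 → Fin 3) ⊓ standardLeviGL F ![false, false, true] : Subgroup (GL (Fin 3) F)) : Set (GL (Fin 3) F)) ∧
      IsLimitOfCompactOpen ↥(unipotentRadicalGL F (id : Fin 3 → Fin 3) ⊓ standardLeviGL F ![false, false, true]) := by
  haveI : T2Space F := (isLocalField F).toT2Space
  have hNc : IsClosed ((unipotentRadicalGL F ![false, false, true] : Subgroup (GL (Fin 3) F)) : Set (GL (Fin 3) F)) := isClosed_unipotentRadicalGL _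
  have hHc : IsClosed ((unipotentRadicalGL F (id : Fin 3 → Fin 3) ⊓ standardLeviGL F ![false, false, true] : Subgroup (GL (Fin 3) F)) : Set (GL (Fin 3) F)) := by
    rw [Subgroup.coe_inf]
    exact (isClosed_unipotentRadicalGL _).inter (isClosed_standardLeviGL _)
  refine ⟨hNc, (isLimitOfCompactOpen_upperUnitriangular F 3).of_le unipotentRadical21_le hNc, hHc,
    (isLimitOfCompactOpen_upperUnitriangular F 3).of_le (fun g hg => hg.1) hHc⟩

/-! ## §1 (A) The torus moves `ψ_nd` -/

section Torus

omit [ValuativeRel F] [TopologicalSpace F] [IsNonarchimedeanLocalField F] in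
/-- **(A) `V(U₃, ψ_nd) = V ⇒ V(U₃, θ_c) = V`**, `θ_c(u) = ψ(c u₀₁ + u₁₂)`, `c ≠ 0` (conjugation by `diag(c,1,1)`, ★ kit `ker_charTwist_eq_top_of_conj`).
[cite: BernsteinZelevinskyASENS1977, Thm. 4.7] -/
theorem ker_charTwist_eq_top_of_whittaker (hnd : Coinvariants.ker (whittakerTwist ω ψ) = ⊤) {c : F} (hc : c ≠ 0)
    (θ : ↥(upperUnitriangular (Fin 3) F) →* ℂˣ)
    (hθ : ∀ u, ((θ u : ℂˣ) : ℂ) = ψ (c * ((u : GL (Fin 3) F) : Matrix (Fin 3) (Fin 3) F) 0 1 + ((u : GL (Fin 3) F) : Matrix (Fin 3) (Fin 3) F) 1 2)) :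
    Coinvariants.ker (ω.charTwist (upperUnitriangular (Fin 3) F) θ) = ⊤ := by
  have hxN : ∀ u : ↥(upperUnitriangular (Fin 3) F),
      (diagonalGL (Fin 3) F ![Units.mk0 c hc, 1, 1])⁻¹ * (u : GL (Fin 3) F) * diagonalGL (Fin 3) F ![Units.mk0 c hc, 1, 1] ∈ upperUnitriangular (Fin 3) F :=
    fun u => (torus_conj_upperUnitriangular (Units.mk0 c hc) u.2).1
  refine ker_charTwist_eq_top_of_conj ω _ (whittakerChar ψ) θ (diagonalGL (Fin 3) F ![Units.mk0 c hc, 1, 1]) hxN (fun u => Units.ext ?_) hnd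
  obtain ⟨-, h01, h12⟩ := torus_conj_upperUnitriangular (Units.mk0 c hc) u.2
  rw [hθ, coe_whittakerChar_three]
  change (ψ (c * (((diagonalGL (Fin 3) F ![Units.mk0 c hc, 1, 1])⁻¹ * (u : GL (Fin 3) F) * diagonalGL (Fin 3) F ![Units.mk0 c hc, 1, 1] : GL (Fin 3) F) :
      Matrix (Fin 3) (Fin 3) F) 0 1 + (((diagonalGL (Fin 3) F ![Units.mk0 c hc, 1, 1])⁻¹ * (u : GL (Fin 3) F) * diagonalGL (Fin 3) F ![Units.mk0 c hc, 1, 1] :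
      GL (Fin 3) F) : Matrix (Fin 3) (Fin 3) F) 1 2) : ℂ) = _
  rw [h01, h12, Units.val_inv_eq_inv_val, Units.val_mk0, ← mul_assoc, mul_inv_cancel₀ hc, one_mul]

end Torus

/-! ## §2 (B)+(C) `V(U_Q, Ψ₁) = V` -/

section UQ

/-- **(B)+(C) `ω_{U₃,ψ_nd} = 0 ∧ ω_{U₃,ψ′} = 0 ⇒ ω_{U_Q,Ψ₁} = 0`** (`Ψ₁(n) = ψ(n₁₂)`): stages `V = V(U_Q,Ψ₁) + V(U_{α₁},χ_c)` for every `c` (§1 + ★ LEV-2), every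
smooth character of `U_{α₁}` is a `χ_c` (★ kit duality), and separation (★ LEV-1) on the `U_{α₁}`-module `V ⧸ V(U_Q,Ψ₁)`.
[cite: BernsteinZelevinskyASENS1977, Thm. 4.7] [cite: Zelevinsky1980, 3.7 (b)] -/
theorem ker_charTwist_unipotentRadical21_eq_top_of_degenerate (hψ : ψ.IsContinuousNontrivial) (hω : ω.IsSmooth)
    (hnd : Coinvariants.ker (whittakerTwist ω ψ) = ⊤)
    (θ' : ↥(upperUnitriangular (Fin 3) F) →* ℂˣ) (hθ' : ∀ u, ((θ' u : ℂˣ) : ℂ) = ψ (((u : GL (Fin 3) F) : Matrix (Fin 3) (Fin 3) F) 1 2))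
    (hdeg : Coinvariants.ker (ω.charTwist (upperUnitriangular (Fin 3) F) θ') = ⊤)
    (Ψ : ↥(unipotentRadicalGL F ![false, false, true]) →* ℂˣ) (hΨ : ∀ n, ((Ψ n : ℂˣ) : ℂ) = ψ (((n : GL (Fin 3) F) : Matrix (Fin 3) (Fin 3) F) 1 2)) :
    Coinvariants.ker (ω.charTwist (unipotentRadicalGL F ![false, false, true]) Ψ) = ⊤ := by
  haveI : SigmaCompactSpace (GL (Fin 3) F) := sigmaCompactSpace_generalLinearGroup F 3
  obtain ⟨-, -, hHc, hHl⟩ := pieces_topology F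
  haveI : SigmaCompactSpace ↥(unipotentRadicalGL F (id : Fin 3 → Fin 3) ⊓ standardLeviGL F ![false, false, true]) := hHc.sigmaCompactSpace
  have hN : unipotentRadicalGL F ![false, false, true] ≤ upperUnitriangular (Fin 3) F := unipotentRadical21_le
  have hH : unipotentRadicalGL F (id : Fin 3 → Fin 3) ⊓ standardLeviGL F ![false, false, true] ≤ upperUnitriangular (Fin 3) F := fun g hg => hg.1
  -- for every `c`, a character `θ_c` of `U₃` with full kernel, restricting to `Ψ` on `N`
  have hθc : ∀ c : F, ∃ θ : ↥(upperUnitriangular (Fin 3) F) →* ℂˣ,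
      (∀ u, ((θ u : ℂˣ) : ℂ) = ψ (c * ((u : GL (Fin 3) F) : Matrix (Fin 3) (Fin 3) F) 0 1 + ((u : GL (Fin 3) F) : Matrix (Fin 3) (Fin 3) F) 1 2)) ∧
        Coinvariants.ker (ω.charTwist (upperUnitriangular (Fin 3) F) θ) = ⊤ := by
    intro c
    obtain ⟨θ, hθ⟩ := exists_character_upperUnitriangular ψ c 1
    have hθ1 : ∀ u, ((θ u : ℂˣ) : ℂ) = ψ (c * ((u : GL (Fin 3) F) : Matrix (Fin 3) (Fin 3) F) 0 1 + ((u : GL (Fin 3) F) : Matrix (Fin 3) (Fin 3) F) 1 2) :=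
      fun u => by rw [hθ, one_mul]
    refine ⟨θ, hθ1, ?_⟩
    by_cases hc : c = 0
    · have hθθ' : θ = θ' := monoidHom_eq_of_coe_eq fun u => by rw [hθ1, hθ', hc, zero_mul, zero_add]
      rw [hθθ']; exact hdeg
    · exact ker_charTwist_eq_top_of_whittaker ω hnd hc θ hθ1
  -- stages: `V = W + V(H, θ_c|H)`
  have hstage : ∀ (θ : ↥(upperUnitriangular (Fin 3) F) →* ℂˣ) (c : F),
      (∀ u, ((θ u : ℂˣ) : ℂ) = ψ (c * ((u : GL (Fin 3) F) : Matrix (Fin 3) (Fin 3) F) 0 1 + ((u : GL (Fin 3) F) : Matrix (Fin 3) (Fin 3) F) 1 2)) →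
      Coinvariants.ker (ω.charTwist (upperUnitriangular (Fin 3) F) θ) = ⊤ →
      Coinvariants.ker (ω.charTwist (unipotentRadicalGL F ![false, false, true]) Ψ) ⊔ Coinvariants.ker (ω.charTwist (unipotentRadicalGL F (id : Fin 3 → Fin 3) ⊓ standardLeviGL F ![false, false, true]) (θ.comp (Subgroup.inclusion hH))) = ⊤ := by
    intro θ c hθ htop
    have hsup := ker_charTwist_eq_sup ω (upperUnitriangular (Fin 3) F) (unipotentRadicalGL F ![false, false, true]) (unipotentRadicalGL F (id : Fin 3 → Fin 3) ⊓ standardLeviGL F ![false, false, true]) hN hH unipotentRadical21_sup_rootGroup_eq θ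
    have hNres : θ.comp (Subgroup.inclusion hN) = Ψ := monoidHom_eq_of_coe_eq fun n => by
      have h01 : (((n : ↥(unipotentRadicalGL F ![false, false, true])) : GL (Fin 3) F) : Matrix (Fin 3) (Fin 3) F) 0 1 = 0 := ((mem_unipotentRadical21_iff _).1 n.2).2
      rw [MonoidHom.comp_apply, hΨ, hθ, Subgroup.coe_inclusion, h01, mul_zero, zero_add]
    rw [hNres] at hsup
    rw [← hsup, htop]
  -- `H` preserves `W = V(U_Q, Ψ)`
  have hWinv : ∀ h : ↥(unipotentRadicalGL F (id : Fin 3 → Fin 3) ⊓ standardLeviGL F ![false, false, true]), Coinvariants.ker (ω.charTwist (unipotentRadicalGL F ![false, false, true]) Ψ) ≤ (Coinvariants.ker (ω.charTwist (unipotentRadicalGL F ![false, false, true]) Ψ)).comap ((ω.comp (unipotentRadicalGL F (id : Fin 3 → Fin 3) ⊓ standardLeviGL F ![false, false, true]).subtype) h) := by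
    intro h
    rw [← Submodule.map_le_iff_le_comap]
    have hconj := fun n : ↥(unipotentRadicalGL F ![false, false, true]) => conj_mem_unipotentRadical21_of_mem_rootGroup (Subgroup.inv_mem _ h.2) n.2
    have hx : ∀ n : ↥(unipotentRadicalGL F ![false, false, true]), ((h : GL (Fin 3) F)⁻¹)⁻¹ * (n : GL (Fin 3) F) * (h : GL (Fin 3) F)⁻¹ ∈ (unipotentRadicalGL F ![false, false, true]) := fun n => (hconj n).1
    have key := map_ker_charTwist_le_of_conj ω (unipotentRadicalGL F ![false, false, true]) Ψ Ψ ((h : GL (Fin 3) F)⁻¹) hx (fun n => Units.ext (by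
      rw [hΨ, hΨ]
      exact congrArg (fun z : F => ((ψ z : Circle) : ℂ)) (hconj n).2))
    rw [inv_inv] at key
    exact key
  have hτ : (Representation.quotient (ω.comp (unipotentRadicalGL F (id : Fin 3 → Fin 3) ⊓ standardLeviGL F ![false, false, true]).subtype) (Coinvariants.ker (ω.charTwist (unipotentRadicalGL F ![false, false, true]) Ψ)) hWinv).IsSmooth :=
    isSmooth_quotient _ _ hWinv (hω.comp (unipotentRadicalGL F (id : Fin 3 → Fin 3) ⊓ standardLeviGL F ![false, false, true]).subtype continuous_subtype_val)
  -- the root parametrisation of `H` and the commutativity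
  obtain ⟨w, hw, hwadd⟩ := exists_homeomorph_rootGroup_fin_three F
  have hcomm : ∀ x y : ↥(unipotentRadicalGL F (id : Fin 3 → Fin 3) ⊓ standardLeviGL F ![false, false, true]), x * y = y * x := fun x y => Subtype.ext (mul_comm_of_mem_rootGroup x.2 y.2)
  obtain ⟨K, hKmono, hKo, hKc, hKcov⟩ := exists_monotone_compactOpen_exhaustion hHl
  -- every vector of `V ⧸ W` dies: separation on `H`
  have hzero : ∀ a : V ⧸ Coinvariants.ker (ω.charTwist (unipotentRadicalGL F ![false, false, true]) Ψ), a = 0 := by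
    intro a
    refine eq_zero_of_forall_mem_ker_coinvariants_twist_of_comm hcomm _ hτ K hKmono hKo hKc hKcov fun χ hχ => ?_
    -- `χ = θ_c|H` for some `c`
    obtain ⟨c, hc⟩ := exists_eq_mulShift_comp_of_isOpen_ker hψ hHl w w.continuous hwadd χ hχ
    obtain ⟨θ, hθ, hθtop⟩ := hθc c
    have hχθ : χ = θ.comp (Subgroup.inclusion hH) := monoidHom_eq_of_coe_eq fun h => by
      obtain ⟨-, h12⟩ := entries_of_mem_rootGroup h.2
      have hh : h = w (w.symm h) := (w.apply_symm_apply h).symm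
      have h01 : (((h : ↥(unipotentRadicalGL F (id : Fin 3 → Fin 3) ⊓ standardLeviGL F ![false, false, true])) : GL (Fin 3) F) : Matrix (Fin 3) (Fin 3) F) 0 1 = w.symm h := by
        conv_lhs => rw [hh, hw]
        simp [Matrix.transvection]
      rw [MonoidHom.comp_apply, hθ, Subgroup.coe_inclusion, h12, add_zero, h01, hh, hc, w.symm_apply_apply]
    have hfull : Coinvariants.ker (ω.charTwist (unipotentRadicalGL F ![false, false, true]) Ψ) ⊔ Coinvariants.ker (Representation.twist (ω.comp (unipotentRadicalGL F (id : Fin 3 → Fin 3) ⊓ standardLeviGL F ![false, false, true]).subtype) χ⁻¹) = ⊤ := by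
      rw [hχθ]
      exact hstage θ c hθ hθtop
    have := ker_twist_quotient_eq_top_of_sup_eq_top (ω.comp (unipotentRadicalGL F (id : Fin 3 → Fin 3) ⊓ standardLeviGL F ![false, false, true]).subtype) _ hWinv χ⁻¹ hfull
    rw [this]
    exact Submodule.mem_top
  refine eq_top_iff.2 fun v _ => ?_
  have hv := hzero ((Coinvariants.ker (ω.charTwist (unipotentRadicalGL F ![false, false, true]) Ψ)).mkQ v)
  rwa [Submodule.mkQ_apply, Submodule.Quotient.mk_eq_zero] at hv

end UQ

/-! ## §3 (D) `U_Q` acts trivially -/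

section Trivial

omit [ValuativeRel F] [TopologicalSpace F] [IsNonarchimedeanLocalField F] in
/-- **(D, transport) `V(U_Q, Ψ₁) = V ⇒ V(U_Q, Ψ_{a,b}) = V` for every `(a,b) ≠ (0,0)`** (`Ψ_{a,b}(n) = ψ(a n₀₂ + b n₁₂)`; the Levi `GL₂` is transitive on the non-trivial
characters of `U_Q ≅ F²`: `T₁₀(a)`, `diag(1,b,1)`, `P_{(01)}`). [cite: BernsteinZelevinskyASENS1977, Thm. 4.7] -/
theorem ker_charTwist_unipotentRadical21_eq_top_of_ne
    (Ψ₁ : ↥(unipotentRadicalGL F ![false, false, true]) →* ℂˣ) (hΨ₁ : ∀ n, ((Ψ₁ n : ℂˣ) : ℂ) = ψ (((n : GL (Fin 3) F) : Matrix (Fin 3) (Fin 3) F) 1 2))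
    (h₁ : Coinvariants.ker (ω.charTwist (unipotentRadicalGL F ![false, false, true]) Ψ₁) = ⊤) {a b : F} (hab : ¬(a = 0 ∧ b = 0))
    (Ψ : ↥(unipotentRadicalGL F ![false, false, true]) →* ℂˣ)
    (hΨ : ∀ n, ((Ψ n : ℂˣ) : ℂ) = ψ (a * ((n : GL (Fin 3) F) : Matrix (Fin 3) (Fin 3) F) 0 2 + b * ((n : GL (Fin 3) F) : Matrix (Fin 3) (Fin 3) F) 1 2)) :
    Coinvariants.ker (ω.charTwist (unipotentRadicalGL F ![false, false, true]) Ψ) = ⊤ := by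
  -- step 1: `Ψ_{c,1}` for every `c`
  have step1 : ∀ c : F, ∀ Θ : ↥(unipotentRadicalGL F ![false, false, true]) →* ℂˣ,
      (∀ n, ((Θ n : ℂˣ) : ℂ) = ψ (c * ((n : GL (Fin 3) F) : Matrix (Fin 3) (Fin 3) F) 0 2 + ((n : GL (Fin 3) F) : Matrix (Fin 3) (Fin 3) F) 1 2)) →
      Coinvariants.ker (ω.charTwist (unipotentRadicalGL F ![false, false, true]) Θ) = ⊤ := by
    intro c Θ hΘ
    refine ker_charTwist_eq_top_of_conj ω (unipotentRadicalGL F ![false, false, true]) Ψ₁ Θ (transvectionGL (1 : Fin 3) 0 (by decide) c)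
      (fun n => (levi_transvection_conj_unipotentRadical21 c n.2).1) (fun n => Units.ext ?_) h₁
    obtain ⟨-, h02, h12⟩ := levi_transvection_conj_unipotentRadical21 c n.2
    rw [hΘ, hΨ₁]
    refine congrArg (fun z : F => ((ψ z : Circle) : ℂ)) ?_
    change c * (((transvectionGL (1 : Fin 3) 0 (by decide) c)⁻¹ * (n : GL (Fin 3) F) * transvectionGL (1 : Fin 3) 0 (by decide) c : GL (Fin 3) F) :
        Matrix (Fin 3) (Fin 3) F) 0 2 + (((transvectionGL (1 : Fin 3) 0 (by decide) c)⁻¹ * (n : GL (Fin 3) F) * transvectionGL (1 : Fin 3) 0 (by decide) c :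
        GL (Fin 3) F) : Matrix (Fin 3) (Fin 3) F) 1 2 = _
    rw [h02, h12]; ring
  -- step 2: `Ψ_{c,b}`, `b ≠ 0`
  have step2 : ∀ (c : F) (b : F), b ≠ 0 → ∀ Θ : ↥(unipotentRadicalGL F ![false, false, true]) →* ℂˣ,
      (∀ n, ((Θ n : ℂˣ) : ℂ) = ψ (c * ((n : GL (Fin 3) F) : Matrix (Fin 3) (Fin 3) F) 0 2 + b * ((n : GL (Fin 3) F) : Matrix (Fin 3) (Fin 3) F) 1 2)) →
      Coinvariants.ker (ω.charTwist (unipotentRadicalGL F ![false, false, true]) Θ) = ⊤ := by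
    intro c b hb Θ hΘ
    obtain ⟨Θ₁, hΘ₁⟩ := exists_character_unipotentRadical ψ c 1
    have hΘ₁' : ∀ n, ((Θ₁ n : ℂˣ) : ℂ) = ψ (c * ((n : GL (Fin 3) F) : Matrix (Fin 3) (Fin 3) F) 0 2 + ((n : GL (Fin 3) F) : Matrix (Fin 3) (Fin 3) F) 1 2) :=
      fun n => by rw [hΘ₁, one_mul]
    refine ker_charTwist_eq_top_of_conj ω (unipotentRadicalGL F ![false, false, true]) Θ₁ Θ (diagonalGL (Fin 3) F ![1, Units.mk0 b hb, 1])
      (fun n => (torus_conj_unipotentRadical21 (Units.mk0 b hb) n.2).1) (fun n => Units.ext ?_) (step1 c Θ₁ hΘ₁')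
    obtain ⟨-, h02, h12⟩ := torus_conj_unipotentRadical21 (Units.mk0 b hb) n.2
    rw [hΘ, hΘ₁']
    refine congrArg (fun z : F => ((ψ z : Circle) : ℂ)) ?_
    change c * (((diagonalGL (Fin 3) F ![1, Units.mk0 b hb, 1])⁻¹ * (n : GL (Fin 3) F) * diagonalGL (Fin 3) F ![1, Units.mk0 b hb, 1] : GL (Fin 3) F) :
        Matrix (Fin 3) (Fin 3) F) 0 2 + b * (((diagonalGL (Fin 3) F ![1, Units.mk0 b hb, 1])⁻¹ * (n : GL (Fin 3) F) * diagonalGL (Fin 3) F ![1, Units.mk0 b hb, 1] :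
        GL (Fin 3) F) : Matrix (Fin 3) (Fin 3) F) 1 2 = _
    rw [h02, h12, Units.val_inv_eq_inv_val, Units.val_mk0, ← mul_assoc, mul_inv_cancel₀ hb, one_mul]
  by_cases hb : b = 0
  · -- `Ψ_{a,0}`, `a ≠ 0`: swap from `Ψ_{0,a}`
    have ha : a ≠ 0 := fun ha => hab ⟨ha, hb⟩
    obtain ⟨Θ₂, hΘ₂⟩ := exists_character_unipotentRadical ψ 0 a
    have h₂ : Coinvariants.ker (ω.charTwist (unipotentRadicalGL F ![false, false, true]) Θ₂) = ⊤ := step2 0 a ha Θ₂ hΘ₂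
    refine ker_charTwist_eq_top_of_conj ω (unipotentRadicalGL F ![false, false, true]) Θ₂ Ψ (permGL (Equiv.swap (0 : Fin 3) 1))
      (fun n => (swap_conj_unipotentRadical21 n.2).1) (fun n => Units.ext ?_) h₂
    obtain ⟨-, h02, h12⟩ := swap_conj_unipotentRadical21 (F := F) n.2
    rw [hΨ, hΘ₂]
    refine congrArg (fun z : F => ((ψ z : Circle) : ℂ)) ?_
    change a * (((permGL (Equiv.swap (0 : Fin 3) 1) : GL (Fin 3) F)⁻¹ * (n : GL (Fin 3) F) * permGL (Equiv.swap (0 : Fin 3) 1) : GL (Fin 3) F) :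
        Matrix (Fin 3) (Fin 3) F) 0 2 + b * (((permGL (Equiv.swap (0 : Fin 3) 1) : GL (Fin 3) F)⁻¹ * (n : GL (Fin 3) F) * permGL (Equiv.swap (0 : Fin 3) 1) :
        GL (Fin 3) F) : Matrix (Fin 3) (Fin 3) F) 1 2 = _
    rw [h02, h12, hb]; ring
  · exact step2 a b hb Ψ hΨ

/-- **(D) `U_Q` ACTS TRIVIALLY on a `ψ_nd`- and `ψ′`-degenerate smooth representation of `GL₃(F)`**: `ω(n) v = v` for `n ∈ U_Q`
(every smooth character of `U_Q ≅ F²` is a `Ψ_{a,b}` (★ kit), `V(U_Q, Ψ_{a,b}) = V` for `(a,b) ≠ 0` (§3 transport), `ω(n)v − v ∈ V(U_Q, 1)`; separation ★ LEV-1).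
[cite: BernsteinZelevinskyASENS1977, Thm. 4.7] [cite: BernsteinZelevinsky1976, §2.33] -/
theorem apply_eq_self_of_mem_unipotentRadical21_of_degenerate (hψ : ψ.IsContinuousNontrivial) (hω : ω.IsSmooth)
    (hnd : Coinvariants.ker (whittakerTwist ω ψ) = ⊤)
    (θ' : ↥(upperUnitriangular (Fin 3) F) →* ℂˣ) (hθ' : ∀ u, ((θ' u : ℂˣ) : ℂ) = ψ (((u : GL (Fin 3) F) : Matrix (Fin 3) (Fin 3) F) 1 2))
    (hdeg : Coinvariants.ker (ω.charTwist (upperUnitriangular (Fin 3) F) θ') = ⊤)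
    {n : GL (Fin 3) F} (hn : n ∈ unipotentRadicalGL F ![false, false, true]) (v : V) : ω n v = v := by
  haveI : SigmaCompactSpace (GL (Fin 3) F) := sigmaCompactSpace_generalLinearGroup F 3
  obtain ⟨hNc, hNl, -, -⟩ := pieces_topology F
  obtain ⟨Ψ₁, hΨ₁⟩ := exists_character_unipotentRadical ψ 0 1
  have hΨ₁' : ∀ m, ((Ψ₁ m : ℂˣ) : ℂ) = ψ (((m : GL (Fin 3) F) : Matrix (Fin 3) (Fin 3) F) 1 2) := fun m => by rw [hΨ₁, zero_mul, one_mul, zero_add]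
  have h₁ := ker_charTwist_unipotentRadical21_eq_top_of_degenerate ω hψ hω hnd θ' hθ' hdeg Ψ₁ hΨ₁'
  -- the two root parametrisations of `U_Q`
  have h02ne : (0 : Fin 3) ≠ 2 := by decide
  have h12ne : (1 : Fin 3) ≠ 2 := by decide
  have hmem02 : ∀ x : F, transvectionGL (0 : Fin 3) 2 h02ne x ∈ unipotentRadicalGL F ![false, false, true] :=
    fun x => transvectionGL_mem_unipotentRadicalGL _ (by decide) x
  have hmem12 : ∀ y : F, transvectionGL (1 : Fin 3) 2 h12ne y ∈ unipotentRadicalGL F ![false, false, true] :=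
    fun y => transvectionGL_mem_unipotentRadicalGL _ (by decide) y
  let e₁ : F → ↥(unipotentRadicalGL F ![false, false, true]) := fun x => ⟨transvectionGL (0 : Fin 3) 2 h02ne x, hmem02 x⟩
  let e₂ : F → ↥(unipotentRadicalGL F ![false, false, true]) := fun y => ⟨transvectionGL (1 : Fin 3) 2 h12ne y, hmem12 y⟩
  haveI : IsTopologicalRing F := inferInstance
  have hcontT : ∀ (i j : Fin 3) (hij : i ≠ j), Continuous fun x : F => transvectionGL i j hij x := by
    intro i j hij
    have hc : Continuous fun x : F => Matrix.transvection i j x := by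
      have : (fun x : F => Matrix.transvection i j x) = fun x => 1 + x • Matrix.single i j (1 : F) := by
        funext x; rw [Matrix.transvection, Matrix.smul_single, smul_eq_mul, mul_one]
      rw [this]; exact continuous_const.add (continuous_id.smul continuous_const)
    have hfun : (fun x : F => (((transvectionGL i j hij x)⁻¹ : GL (Fin 3) F) : Matrix (Fin 3) (Fin 3) F)) = fun x => Matrix.transvection i j (-x) := by
      funext x; rw [← transvectionGL_neg, coe_transvectionGL]
    rw [Units.continuous_iff]
    refine ⟨hc, ?_⟩
    rw [hfun]
    exact hc.comp continuous_neg
  have he₁c : Continuous e₁ := (hcontT 0 2 h02ne).subtype_mk _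
  have he₂c : Continuous e₂ := (hcontT 1 2 h12ne).subtype_mk _
  have hadd : ∀ (i j : Fin 3) (hij : i ≠ j) (x y : F), transvectionGL i j hij (x + y) = transvectionGL i j hij x * transvectionGL i j hij y :=
    fun i j hij x y => Units.ext (by rw [Units.val_mul, coe_transvectionGL, coe_transvectionGL, coe_transvectionGL, Matrix.transvection_mul_transvection_same _ _ hij])
  have he₁add : ∀ x y, e₁ (x + y) = e₁ x * e₁ y := fun x y => Subtype.ext (hadd 0 2 h02ne x y)
  have he₂add : ∀ x y, e₂ (x + y) = e₂ x * e₂ y := fun x y => Subtype.ext (hadd 1 2 h12ne x y)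
  -- every element of `U_Q` is `e₁(n₀₂) e₂(n₁₂)`
  have hdecomp : ∀ m : ↥(unipotentRadicalGL F ![false, false, true]), m = e₁ ((((m : GL (Fin 3) F)) : Matrix (Fin 3) (Fin 3) F) 0 2) * e₂ ((((m : GL (Fin 3) F)) : Matrix (Fin 3) (Fin 3) F) 1 2) := by
    intro m
    refine Subtype.ext (eq_of_mem_unipotentRadical21 m.2 (Subgroup.mul_mem _ (hmem02 _) (hmem12 _)) ?_ ?_)
    · rw [Subgroup.coe_mul, apply02_mul_of_mem_unipotentRadical21 (hmem02 _) (hmem12 _)]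
      simp [transvectionGL_apply]
    · rw [Subgroup.coe_mul, (superdiag_apply_mul (unipotentRadical21_le (hmem02 _)) (unipotentRadical21_le (hmem12 _))).2]
      simp [transvectionGL_apply]
  -- separation on `U_Q` applied to `ω(n)v − v`
  have hcomm : ∀ x y : ↥(unipotentRadicalGL F ![false, false, true]), x * y = y * x := fun x y => Subtype.ext (mul_comm_of_mem_unipotentRadical21 x.2 y.2)
  refine sub_eq_zero.1 (eq_zero_of_forall_mem_ker_charTwist_of_isClosed ω hω (unipotentRadicalGL F ![false, false, true]) hcomm hNc hNl fun χ hχ => ?_)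
  obtain ⟨a, b, hab⟩ := exists_eq_addChar_of_isOpen_ker_two hψ hNl e₁ e₂ he₁c he₂c he₁add he₂add χ hχ
  have hχ' : ∀ m : ↥(unipotentRadicalGL F ![false, false, true]), ((χ m : ℂˣ) : ℂ) = ψ (a * (((m : GL (Fin 3) F)) : Matrix (Fin 3) (Fin 3) F) 0 2 + b * (((m : GL (Fin 3) F)) : Matrix (Fin 3) (Fin 3) F) 1 2) :=
    fun m => by conv_lhs => rw [hdecomp m]; exact hab _ _
  by_cases h0 : a = 0 ∧ b = 0
  · -- the trivial character: `ω(n)v − v` is a generator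
    have hone : χ ⟨n, hn⟩ = 1 := Units.ext (by rw [hχ', h0.1, h0.2, zero_mul, zero_mul, add_zero, AddChar.map_zero_eq_one, Units.val_one, Circle.coe_one])
    have := sub_smul_mem_ker_charTwist ω (unipotentRadicalGL F ![false, false, true]) χ ⟨n, hn⟩ v
    rwa [hone, one_smul] at this
  · rw [ker_charTwist_unipotentRadical21_eq_top_of_ne ω Ψ₁ hΨ₁' h₁ h0 χ hχ']
    exact Submodule.mem_top

end Trivial

end Summit.HodgeConjecture.HodgeConjecture.Cruxes.H413.K2E3GL3DegenerateUnipotentTrivial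

end
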